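import Summits.BirchSwinnertonDyer.BirchSwinnertonDyer.Theorems.GoldfeldAllTwistsTwoConverseTwinAdditiveTwoPrimesTwistHalvabilityCore
import Summits.BirchSwinnertonDyer.BirchSwinnertonDyer.Theorems.GoldfeldAllTwistsTwoConverseTwinAdditiveTwoPrimesTwistDescent
import HarnessLib

set_option linter.dupNamespace false -- namespace `…BirchSwinnertonDyer.BirchSwinnertonDyer…` is the cell's (D-0017 nested layout)
set_option autoImplicit false

/-!
# Twin″ (item 19140), LINE B⁗ T3-I part a: the HALVABILITY VALUE is `k = 1` for `49a1^{(−2qp)}` over `K = ℚ(√−2qp)` on the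
# cells C4 ∪ C6 ∪ C8 — fact-free, from the complete `2`-descent of T3-D

Cell `bsd-goldfeld`, seat `bsd-goldfeld-s1p-c3x` (gen 11); planner ORDER (cccxvii) «LINE B⁗ — TRANCHE 3», object T3-I, file a
(announced split T3-I-a / T3-I-b; the generic core is `…TwinAdditiveTwoPrimesTwistHalvabilityCore`). `--supports stmt-BirchSwinnertonDyer-19140`
as a HELPER (twin″ `BSDTwoCMSevenAdditiveRankOne`). FACT-FREE: no print binder, no definition, no `sorry`. HONEST FRAMING: a statement
about the Mordell–Weil groups of the twist-density-ZERO two-prime family `49a1^{(−2qp)}`; nothing about `L`-values; BSD is not proved by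
any of this and the item stays open; the rank-one hypothesis is a binder (on the family it is A⁗ + GZK).

THE BIT. With `I = [X₀(49)(K) : ℤP] = 2|c|·|a|` (`P = n•y`, `|n| = |c|`, `y = a•g + t`) the B⁗ factor table (`c_W = 64`, `t_W = t_K = w_K = 2`,
`n_∞ = |u| = 1`, `ord₂ tq = −1`) gives `𝔮₄₉ = a²/(8k²·tq)`, `ord₂ 𝔮₄₉ = 2·ord₂ a − 2 − 2·ord₂ k`; X5β-χ (`…TwinQuarterTraceChiZBeta`) pins
`ord₂ a = 1`, so `BSD(W,2) ⟺ k = 1` — the halvability value must be DECIDED (in the `k = 2` branch the half `R₀` of the trace is not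
anti-invariant, `cR₀ = −R₀ + T`, and B″'s `index_zmultiples_eq_of_antiOddType` does not apply). `k = 2` ⟺ the generator of `X₀(49)(K)`
is not anti-invariant ⟺ `[−2qp] ∈ α′(E′(ℚ)) ⊆ S′(84qp, −28q²p²)`, and T3-D part 3b kills every class of `S′` divisible by `p`.

WHAT IS PROVED (`E = ⟨0, −42qp, 0, 448q²p², 0⟩` T3-D's model, `E′ = ⟨0, 84qp, 0, −28q²p², 0⟩ = E.twoIsogenyCodomain`; hypotheses
`q ≡ 3 (4)` prime, `(q/7) = −1`, `p ≡ 5 (8)` prime, `(−7/p) = 1`, `(p/q) = −1`, `hcell : q ≡ 7 (8) ∨ −7 ∈ (ℤ/p)^{×4}` exactly as in T3-D):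
* `xSqClass_codomain_ne_of_prime_dvd`: no class of `α′(E′(ℚ))` is `[c]` for a squarefree `c` with `p ∣ c` (`α′(E′(ℚ)) ⊆ S′`,
  Literature `range_xSqClass_subset_image_twoIsogenySelmerGroup`; T3-D `not_prime_dvd_of_mem_twoIsogenySelmerGroup'_twoPrimesTwist`);
* `not_forall_halvable_twoTorsionModel_twoPrimesTwist` (the core's `not_forall_halvable_of_descent` with `a² − 4b = −7·(2qp)²`,
  `b = 7·(8qp)²` non-squares in `K`, the excluded classes `[d_K] = [−2qp]`, `[a′₄d_K] = [14qp]`, and `#α(E(ℚ)) ≤ #S ≤ 2` from T3-D part 2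
  `card_twoIsogenySelmerGroup_twoPrimesTwist_le`);
* **`not_forall_halvable_twoPrimesTwist`**: for `K` imaginary quadratic with `d_K = −8qp` and ANY elliptic `W/ℚ` with
  `C • W = X₀(49)^{(−2qp)}`, `rank W(ℚ) = 1`: NOT every `y ∈ W(ℚ)` is divisible by `2` in `W(K)` up to torsion — `k = 1`.
NUMERICS: kit j304181 (`[X₀(49)(K) : X₀(49)(K)⁻] = 1`, i.e. `k = 1`, on all 162 pairs `qp ≤ 60000`).
References: [SilvermanTate2015] §3.4–3.6; [SilvermanAEC2009] III.4.5, X.4.9, X.4.10, Exercise 10.16.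
-/

noncomputable section

open scoped Classical

open WeierstrassCurve Literature.NumberTheory.EllipticCurves Literature.NumberTheory.EllipticCurves.ModularForms
  WeierstrassCurve.QuadraticDescent
open WeierstrassCurve.Affine (sqClass sqClass_mul sqClass_eq_one_iff)

namespace Summit.BirchSwinnertonDyer.BirchSwinnertonDyer.Theorems.GoldfeldGoodTwists

/-! ## `k = 1` on the B⁗ family: `E = ⟨0, −42qp, 0, 448q²p², 0⟩`, `E′ = ⟨0, 84qp, 0, −28q²p², 0⟩`, `K = ℚ(√−2qp)` -/

section HalvabilityTwoPrimes

variable {K : Type} [Field K] [NumberField K] {q p : ℕ} [Fact q.Prime] [Fact p.Prime]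

/-- Squarefree integers with the same square class in `ℚ^×/ℚ^{×2}` are equal (tree `eq_of_squarefree_of_mul_eq_sq`). [folklore] -/
private theorem eq_of_squarefree_of_sqClass_intCast_eq_b4 {d₁ d₂ : ℤ} (h₁ : Squarefree d₁) (h₂ : Squarefree d₂)
    (he : sqClass (d₁ : ℚ) = sqClass (d₂ : ℚ)) : d₁ = d₂ := by
  have h0₁ : (d₁ : ℚ) ≠ 0 := by exact_mod_cast h₁.ne_zero
  have h0₂ : (d₂ : ℚ) ≠ 0 := by exact_mod_cast h₂.ne_zero
  have h1 : sqClass ((d₁ : ℚ) * d₂) = 1 := by rw [sqClass_mul h0₁ h0₂, he, Affine.SqUnits.mul_self]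
  obtain ⟨u, hu⟩ := (sqClass_eq_one_iff (mul_ne_zero h0₁ h0₂)).mp h1
  obtain ⟨m, hm⟩ : IsSquare (d₁ * d₂) := by
    rw [← Rat.isSquare_intCast_iff]
    exact ⟨u, by push_cast; rw [hu, pow_two]⟩
  exact eq_of_squarefree_of_mul_eq_sq h₁ h₂ (m := m) (by rw [hm, pow_two])

/-- `c·t²` and `c` have the same square class (`t ≠ 0`, `c ≠ 0`). [folklore] -/
private theorem sqClass_mul_sq_eq_b4 {c t : ℚ} (hc : c ≠ 0) (ht : t ≠ 0) : sqClass (c * t ^ 2) = sqClass c := by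
  rw [sqClass_mul hc (pow_ne_zero 2 ht), Affine.sqClass_sq, Affine.SqUnits.mul_one]

/-- The arithmetic of the cells: `q ≠ 2, 7`, `p ≠ 2, 7`, `q ≠ p`; `−2qp` and `14qp` are squarefree. [folklore] -/
private theorem cell_arith_negTwoQP (hq4 : q % 4 = 3) (hq7 : jacobiSym q 7 = -1) (hp8 : p % 8 = 5) :
    (q ≠ 2 ∧ q ≠ 7 ∧ p ≠ 2 ∧ p ≠ 7 ∧ q ≠ p) ∧ Squarefree (-2 * ((q : ℤ) * p)) ∧ Squarefree (14 * ((q : ℤ) * p)) := by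
  have hq : q.Prime := Fact.out
  have hp : p.Prime := Fact.out
  obtain ⟨hq2, hq7'⟩ := ne_two_and_ne_seven_of_jacobiSym hq7
  have hp2 : p ≠ 2 := by rintro rfl; norm_num at hp8
  have hp7' : p ≠ 7 := by rintro rfl; norm_num at hp8
  have hqp : q ≠ p := by rintro rfl; omega
  have h2q : Nat.Coprime 2 q := (Nat.coprime_primes Nat.prime_two hq).mpr (Ne.symm hq2)
  have h2p : Nat.Coprime 2 p := (Nat.coprime_primes Nat.prime_two hp).mpr (Ne.symm hp2)
  have h7q : Nat.Coprime 7 q := (Nat.coprime_primes (by norm_num) hq).mpr (Ne.symm hq7')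
  have h7p : Nat.Coprime 7 p := (Nat.coprime_primes (by norm_num) hp).mpr (Ne.symm hp7')
  have hqp' : Nat.Coprime q p := (Nat.coprime_primes hq hp).mpr hqp
  have hqpS : Squarefree (q * p) := (Nat.squarefree_mul hqp').mpr ⟨hq.squarefree, hp.squarefree⟩
  have h2 : Squarefree (((2 * (q * p) : ℕ) : ℤ)) := Int.squarefree_natCast.mpr
    ((Nat.squarefree_mul (Nat.Coprime.mul_right h2q h2p)).mpr ⟨Nat.squarefree_two, hqpS⟩)
  have h14' : Squarefree (14 : ℕ) := by
    rw [show (14 : ℕ) = 2 * 7 by norm_num]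
    exact (Nat.squarefree_mul (by norm_num)).mpr ⟨Nat.squarefree_two, (by norm_num : Nat.Prime 7).squarefree⟩
  have h14 : Squarefree (((14 * (q * p) : ℕ) : ℤ)) := by
    refine Int.squarefree_natCast.mpr ((Nat.squarefree_mul ?_).mpr ⟨h14', hqpS⟩)
    rw [show (14 : ℕ) = 2 * 7 by norm_num]
    exact Nat.Coprime.mul_left (Nat.Coprime.mul_right h2q h2p) (Nat.Coprime.mul_right h7q h7p)
  refine ⟨⟨hq2, hq7', hp2, hp7', hqp⟩, h2.squarefree_of_dvd ⟨-1, by push_cast; ring⟩, ?_⟩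
  exact_mod_cast h14

/-- **No class of `α′(E′(ℚ))` is the class of a squarefree integer divisible by `p`** (`E′ = ⟨0, 84qp, 0, −28q²p², 0⟩` the
`2`-isogenous curve of T3-D's model): `α′(E′(ℚ)) ⊆ S′(84qp, −28q²p²)` (Literature `range_xSqClass_subset_image_twoIsogenySelmerGroup`),
square classes of squarefree integers determine them, and no class of `S′` is divisible by `p` (T3-D part 3b
`not_prime_dvd_of_mem_twoIsogenySelmerGroup'_twoPrimesTwist`, cells C4 ∪ C6 ∪ C8). [cite: SilvermanAEC2009, Prop. X.4.9 and Example X.4.10]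
[cite: SilvermanTate2015, §3.6] -/
theorem xSqClass_codomain_ne_of_prime_dvd (hq4 : q % 4 = 3) (hq7 : jacobiSym q 7 = -1) (hp8 : p % 8 = 5)
    (hp7 : legendreSym p (-7) = 1) (hpq : jacobiSym p q = -1) (hcell : q % 8 = 7 ∨ ∃ x : ZMod p, x ^ 4 = -7)
    [(⟨0, ((-42 * ((q : ℤ) * p) : ℤ) : ℚ), 0, ((448 * ((q : ℤ) * p) ^ 2 : ℤ) : ℚ), 0⟩ : WeierstrassCurve ℚ).IsElliptic]
    (h' : (⟨0, ((-42 * ((q : ℤ) * p) : ℤ) : ℚ), 0, ((448 * ((q : ℤ) * p) ^ 2 : ℤ) : ℚ), 0⟩ :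
      WeierstrassCurve ℚ).twoIsogenyCodomain.toAffine.Point)
    {c : ℤ} (hc : Squarefree c) (hpc : (p : ℤ) ∣ c) :
    (⟨0, ((-42 * ((q : ℤ) * p) : ℤ) : ℚ), 0, ((448 * ((q : ℤ) * p) ^ 2 : ℤ) : ℚ), 0⟩ :
      WeierstrassCurve ℚ).twoIsogenyCodomain.xSqClass h' ≠ sqClass (c : ℚ) := by
  have hq : q.Prime := Fact.out
  have hp : p.Prime := Fact.out
  have hq0 : (q : ℤ) ≠ 0 := by exact_mod_cast hq.ne_zero
  have hp0 : (p : ℤ) ≠ 0 := by exact_mod_cast hp.ne_zero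
  intro hch
  -- `α′(E′(ℚ)) ⊆ [S′]`
  have hA : (-2 * (-42 * ((q : ℤ) * p))) = 84 * ((q : ℤ) * p) := by ring
  have hB : ((-42 * ((q : ℤ) * p)) ^ 2 - 4 * (448 * ((q : ℤ) * p) ^ 2)) = -28 * ((q : ℤ) * p) ^ 2 := by ring
  have hb : (-28 * ((q : ℤ) * p) ^ 2 : ℤ) ≠ 0 := mul_ne_zero (by norm_num) (pow_ne_zero 2 (mul_ne_zero hq0 hp0))
  have hab' : ((-42 * ((q : ℤ) * p)) ^ 2 - 4 * (448 * ((q : ℤ) * p) ^ 2)) *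
      ((-2 * (-42 * ((q : ℤ) * p))) ^ 2 - 4 * ((-42 * ((q : ℤ) * p)) ^ 2 - 4 * (448 * ((q : ℤ) * p) ^ 2))) ≠ 0 := by
    rw [hA, hB]
    refine mul_ne_zero hb ?_
    rw [show (84 * ((q : ℤ) * p)) ^ 2 - 4 * (-28 * ((q : ℤ) * p) ^ 2) = 7168 * ((q : ℤ) * p) ^ 2 by ring]
    exact mul_ne_zero (by norm_num) (pow_ne_zero 2 (mul_ne_zero hq0 hp0))
  have hsub := range_xSqClass_subset_image_twoIsogenySelmerGroup hab'
  rw [← twoIsogenyCodomain_mk_intCast] at hsub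
  have hmem := hsub ⟨h', rfl⟩
  rw [Finset.coe_image] at hmem
  obtain ⟨d₁, hd₁, hd₁c⟩ := hmem
  rw [Finset.mem_coe, hA, hB, mem_twoIsogenySelmerGroup_iff hb] at hd₁
  obtain ⟨hsqf, ⟨d', hdd'⟩, hloc⟩ := hd₁
  -- `d₁ = c`, so `p ∣ d₁`
  have heq : d₁ = c := eq_of_squarefree_of_sqClass_intCast_eq_b4 hsqf hc (hd₁c.trans hch)
  have hd'eq : (-28 * ((q : ℤ) * p) ^ 2 : ℤ) / d₁ = d' := by rw [hdd', Int.mul_ediv_cancel_left _ hsqf.ne_zero]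
  rw [hd'eq] at hloc
  obtain ⟨-, hpadic⟩ := hloc
  exact not_prime_dvd_of_mem_twoIsogenySelmerGroup'_twoPrimesTwist hq4 hq7 hp8 hp7 hpq hcell hsqf hdd' hpadic (heq ▸ hpc)

/-- **THE HALVABILITY VALUE IS `k = 1` ON THE TWO-TORSION MODEL.** For `q ≡ 3 (4)` prime with `(q/7) = −1`, `p ≡ 5 (8)` prime with
`(−7/p) = 1`, `(p/q) = −1`, `hcell`, `K` imaginary quadratic with `d_K = −8qp`, and `E = ⟨0, −42qp, 0, 448q²p², 0⟩` of rank one: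
NOT every `y ∈ E(ℚ)` is divisible by `2` in `E(K)` up to torsion. (the core's `not_forall_halvable_of_descent` with `a² − 4b = −7·(2qp)²`, `b = 7·(8qp)²` non-squares in
`K` (core §1), the excluded classes `[d_K] = [−2qp]`, `[a′₄d_K] = [14qp]` both divisible by `p`, and `#α(E(ℚ)) ≤ #S ≤ 2` (T3-D part 2
`card_twoIsogenySelmerGroup_twoPrimesTwist_le`).) [cite: SilvermanTate2015, §3.5–3.6] [cite: SilvermanAEC2009, Prop. X.4.9 and Exercise 10.16] -/
theorem not_forall_halvable_twoTorsionModel_twoPrimesTwist (hK : IsImaginaryQuadratic K) (hq4 : q % 4 = 3)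
    (hq7 : jacobiSym q 7 = -1) (hp8 : p % 8 = 5) (hp7 : legendreSym p (-7) = 1) (hpq : jacobiSym p q = -1)
    (hcell : q % 8 = 7 ∨ ∃ x : ZMod p, x ^ 4 = -7) (hdK : NumberField.discr K = -(8 * (q : ℤ) * p))
    [(⟨0, ((-42 * ((q : ℤ) * p) : ℤ) : ℚ), 0, ((448 * ((q : ℤ) * p) ^ 2 : ℤ) : ℚ), 0⟩ : WeierstrassCurve ℚ).IsElliptic]
    (hr : (⟨0, ((-42 * ((q : ℤ) * p) : ℤ) : ℚ), 0, ((448 * ((q : ℤ) * p) ^ 2 : ℤ) : ℚ), 0⟩ :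
      WeierstrassCurve ℚ).mordellWeilRank = 1) :
    ¬ ∀ y : (⟨0, ((-42 * ((q : ℤ) * p) : ℤ) : ℚ), 0, ((448 * ((q : ℤ) * p) ^ 2 : ℤ) : ℚ), 0⟩ : WeierstrassCurve ℚ).toAffine.Point,
      ∃ Q : ((⟨0, ((-42 * ((q : ℤ) * p) : ℤ) : ℚ), 0, ((448 * ((q : ℤ) * p) ^ 2 : ℤ) : ℚ), 0⟩ :
        WeierstrassCurve ℚ).baseChange K).toAffine.Point,
        incl K (⟨0, ((-42 * ((q : ℤ) * p) : ℤ) : ℚ), 0, ((448 * ((q : ℤ) * p) ^ 2 : ℤ) : ℚ), 0⟩ : WeierstrassCurve ℚ) y -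
          (2 : ℤ) • Q ∈ AddCommGroup.torsion _ := by
  have hq : q.Prime := Fact.out
  have hp : p.Prime := Fact.out
  obtain ⟨⟨hq2, hq7', hp2, hp7', hqp⟩, hsqf2, hsqf14⟩ := cell_arith_negTwoQP (q := q) (p := p) hq4 hq7 hp8
  obtain ⟨h7, h7'⟩ := not_isSquare_seven_negEightTwoPrimesField hK hq hp hq7' hp7' hdK
  have hqQ : (q : ℚ) ≠ 0 := by exact_mod_cast hq.ne_zero
  have hpQ : (p : ℚ) ≠ 0 := by exact_mod_cast hp.ne_zero
  have hqK : (q : K) ≠ 0 := by exact_mod_cast hq.ne_zero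
  have hpK : (p : K) ≠ 0 := by exact_mod_cast hp.ne_zero
  have hdQ : ((NumberField.discr K : ℤ) : ℚ) = -(8 * (q : ℚ) * p) := by rw [hdK]; push_cast; ring
  -- `#α(E(ℚ)) ≤ #S ≤ 2`
  have hab := hab_inertTwoTwist (m := q * p) (Nat.mul_pos hq.pos hp.pos)
  push_cast at hab
  have hα := (natCard_range_xSqClass_le hab).2.trans (card_twoIsogenySelmerGroup_twoPrimesTwist_le hq4 hq7 hp8 hp7 hpq hcell)
  refine not_forall_halvable_of_descent hK _ ?_ ?_ (fun P ↦ ⟨?_, ?_⟩) hα hr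
  · -- `a² − 4b = −7·(2qp)² ∉ K²`
    rintro ⟨r, hr'⟩
    simp only [WeierstrassCurve.baseChange, WeierstrassCurve.map_a₂, WeierstrassCurve.map_a₄, eq_ratCast] at hr'
    push_cast at hr'
    exact h7 (isSquare_of_sq_mul (k := 2 * ((q : K) * p)) (mul_ne_zero two_ne_zero (mul_ne_zero hqK hpK)) (r := r)
      (by linear_combination hr'.symm))
  · -- `b = 7·(8qp)² ∉ K²`
    rintro ⟨r, hr'⟩
    simp only [WeierstrassCurve.baseChange, WeierstrassCurve.map_a₄, eq_ratCast] at hr'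
    push_cast at hr'
    exact h7' (isSquare_of_sq_mul (k := 8 * ((q : K) * p)) (mul_ne_zero (by norm_num) (mul_ne_zero hqK hpK)) (r := r)
      (by linear_combination hr'.symm))
  · -- `[d_K] = [−2qp]` is excluded
    have hsq1 : sqClass ((NumberField.discr K : ℤ) : ℚ) = sqClass (((-2 * ((q : ℤ) * p) : ℤ)) : ℚ) := by
      rw [hdQ, show (-(8 * (q : ℚ) * p)) = (((-2 * ((q : ℤ) * p) : ℤ)) : ℚ) * 2 ^ 2 by push_cast; ring]
      exact sqClass_mul_sq_eq_b4 (by push_cast; exact mul_ne_zero (by norm_num) (mul_ne_zero hqQ hpQ)) two_ne_zero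
    rw [hsq1]
    exact xSqClass_codomain_ne_of_prime_dvd hq4 hq7 hp8 hp7 hpq hcell P hsqf2 ⟨-2 * q, by ring⟩
  · -- `[a′₄·d_K] = [14qp]` is excluded
    have hsq2 : sqClass ((⟨0, ((-42 * ((q : ℤ) * p) : ℤ) : ℚ), 0, ((448 * ((q : ℤ) * p) ^ 2 : ℤ) : ℚ), 0⟩ :
        WeierstrassCurve ℚ).twoIsogenyCodomain.a₄ * ((NumberField.discr K : ℤ) : ℚ)) = sqClass (((14 * ((q : ℤ) * p) : ℤ)) : ℚ) := by
      rw [twoIsogenyCodomain_a₄, hdQ]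
      push_cast
      rw [show ((-42 * ((q : ℚ) * p)) ^ 2 - 4 * (448 * ((q : ℚ) * p) ^ 2)) * -(8 * (q : ℚ) * p) =
        (14 * ((q : ℚ) * p)) * (4 * ((q : ℚ) * p)) ^ 2 by ring]
      exact sqClass_mul_sq_eq_b4 (mul_ne_zero (by norm_num) (mul_ne_zero hqQ hpQ)) (mul_ne_zero (by norm_num) (mul_ne_zero hqQ hpQ))
    rw [hsq2]
    exact xSqClass_codomain_ne_of_prime_dvd hq4 hq7 hp8 hp7 hpq hcell P hsqf14 ⟨14 * q, by ring⟩

/-- **THE HALVABILITY VALUE IS `k = 1` ON THE WHOLE B⁗ FAMILY.** For `q ≡ 3 (4)` prime with `(q/7) = −1`, `p ≡ 5 (8)` prime with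
`(−7/p) = 1`, `(p/q) = −1`, `hcell : q ≡ 7 (8) ∨ −7 ∈ (ℤ/p)^{×4}` (cells C4 ∪ C6 ∪ C8), `K` imaginary quadratic with `d_K = −8qp`, and
ANY elliptic `W/ℚ` with `C • W = X₀(49)^{(−2qp)}` and `rank W(ℚ) = 1`: NOT every `y ∈ W(ℚ)` is divisible by `2` in `W(K)` up to torsion.
(Transport along the `ℚ`-isomorphism `(⟨½, 2d, 0, 0⟩·C) • W = E` and its base change to `K`, as in F2's
`not_forall_halvable_twoPrimeTwist`.) In `shaAn_eq_x049HeegnerTwistQuotient_of_heegner` this empties the `k = 2` branch on the B⁗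
family; UNCONDITIONAL given rank one (which on the family is A⁗ + GZK). [cite: SilvermanTate2015, §3.5–3.6]
[cite: SilvermanAEC2009, Prop. X.4.9 and Exercise 10.16] -/
theorem not_forall_halvable_twoPrimesTwist (hK : IsImaginaryQuadratic K) (hq4 : q % 4 = 3) (hq7 : jacobiSym q 7 = -1)
    (hp8 : p % 8 = 5) (hp7 : legendreSym p (-7) = 1) (hpq : jacobiSym p q = -1) (hcell : q % 8 = 7 ∨ ∃ x : ZMod p, x ^ 4 = -7)
    (hdK : NumberField.discr K = -(8 * (q : ℤ) * p))
    (W : WeierstrassCurve ℚ) [W.IsElliptic] (C₁ : VariableChange ℚ)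
    (hC₁ : C₁ • W = cm7.quadraticTwist ((-2 * ((q : ℤ) * p) : ℤ) : ℚ)) (hr : W.mordellWeilRank = 1) :
    ¬ ∀ y : W.toAffine.Point, ∃ Q : (W.baseChange K).toAffine.Point,
        incl K W y - (2 : ℤ) • Q ∈ AddCommGroup.torsion (W.baseChange K).toAffine.Point := by
  have hq : q.Prime := Fact.out
  have hp : p.Prime := Fact.out
  -- `C • W = E`
  have hCE := (smul_eq_twoTorsionModel_of_smul_eq_quadraticTwist (-2 * ((q : ℤ) * p)) W C₁ hC₁).trans
    (show (⟨0, ((21 * (-2 * ((q : ℤ) * p)) : ℤ) : ℚ), 0, ((112 * (-2 * ((q : ℤ) * p)) ^ 2 : ℤ) : ℚ), 0⟩ :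
        WeierstrassCurve ℚ) = ⟨0, ((-42 * ((q : ℤ) * p) : ℤ) : ℚ), 0, ((448 * ((q : ℤ) * p) ^ 2 : ℤ) : ℚ), 0⟩ by
      ext <;> push_cast <;> ring)
  set C : VariableChange ℚ := ⟨(Units.mk0 (2 : ℚ) two_ne_zero)⁻¹, 2 * ((-2 * ((q : ℤ) * p) : ℤ) : ℚ), 0, 0⟩ * C₁ with hC
  haveI hE : (⟨0, ((-42 * ((q : ℤ) * p) : ℤ) : ℚ), 0, ((448 * ((q : ℤ) * p) ^ 2 : ℤ) : ℚ), 0⟩ : WeierstrassCurve ℚ).IsElliptic := by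
    rw [← hCE]; infer_instance
  -- rank transport
  have hrE : (⟨0, ((-42 * ((q : ℤ) * p) : ℤ) : ℚ), 0, ((448 * ((q : ℤ) * p) ^ 2 : ℤ) : ℚ), 0⟩ :
      WeierstrassCurve ℚ).mordellWeilRank = 1 := by
    rw [← mordellWeilRank_congr hCE, ← hr]
    have h := mordellWeilRank_variableChange_holds W C
    unfold mordellWeilRank_variableChange at h
    convert h using 2
  intro hall
  refine not_forall_halvable_twoTorsionModel_twoPrimesTwist hK hq4 hq7 hp8 hp7 hpq hcell hdK hrE fun P ↦ ?_
  -- the rational point `y = C⁻¹ • P` of `W` and its hypothetical half `Q ∈ W(K)`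
  set e₀ := (VariableChange.pointEquiv W C).trans (Affine.Point.congrEquiv hCE) with he₀
  obtain ⟨Q, hQ⟩ := hall (e₀.symm P)
  -- push forward to `E(K)`
  set Φ := (VariableChange.pointEquivBaseChange W C K).trans
    (Affine.Point.congrEquiv (congrArg (fun V : WeierstrassCurve ℚ => V.baseChange K) hCE)) with hΦ
  have hΦy : Φ (incl K W (e₀.symm P)) = incl K _ P := by
    rw [hΦ, AddEquiv.trans_apply, pointEquivBaseChange_incl, congrEquiv_incl hCE]
    congr 1
    rw [he₀]
    simp only [AddEquiv.symm_trans_apply]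
    rw [AddEquiv.apply_symm_apply, AddEquiv.apply_symm_apply]
  refine ⟨Φ Q, (AddCommGroup.mem_torsion _).mpr ?_⟩
  rw [← hΦy, ← map_zsmul, ← map_sub]
  exact Φ.toAddMonoidHom.isOfFinAddOrder ((AddCommGroup.mem_torsion _).mp hQ)

end HalvabilityTwoPrimes

end Summit.BirchSwinnertonDyer.BirchSwinnertonDyer.Theorems.GoldfeldGoodTwists

end
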